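import Summits.ResolutionOfSingularities.ResolutionOfSingularities.Theses.WeightedInvariant
import Summits.ResolutionOfSingularities.ResolutionOfSingularities.Theorems.WeightedInvariantDescentPerfectToAllPerfectBaseResolution
import Summits.ResolutionOfSingularities.ResolutionOfSingularities.Theorems.WeightedInvariantDescentPerfectToAllDescendResolutionData
import Summits.ResolutionOfSingularities.ResolutionOfSingularities.Theorems.WeightedInvariantDescentPerfectToAllDescendResolutionProps
import Summits.ResolutionOfSingularities.ResolutionOfSingularities.Theorems.WeightedInvariantDescentPerfectToAllTowerInduction

/-!
# `DescentPerfectToAll` (stmt-ResolutionOfSingularities-0549) is EQUIVALENT to the one-root-of-a-constant step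

Route `ResolutionOfSingularities/WeightedInvariant` (crux shared verbatim with `Descent` and `UniformComplexity`),
line `root-of-a-constant` of the lead prover-line-stmt-ResolutionOfSingularities-0549-c1-0. Four registered stubs of
the lead skeleton `Cruxes/DescentPerfectToAll/Lines/root_of_a_constant.lean` are theorems of the tree
(`stub_perfectBaseResolution` p97850, `stub_descendResolutionData` p99203, `stub_descendResolutionProps` p105404,
`stub_towerInduction` p102084). This file records, sorry-free, what they buy:

* `descentPerfectToAll_of_oneRootStep` — **the crux follows from the one-root step alone**: if, assuming resolution
  over all perfect fields of characteristic `p`, a resolution of the reduction of `X ⊗_k k(a^{1/p})` always yields a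
  resolution of the reduced separated finite-type `k`-scheme `X` (`a ∈ k ∖ k^p`), then `DescentPerfectToAll` holds.
  Proof = the line's composition: resolve `(X ⊗_k Ω)_red` over the perfect closure `Ω = perfectClosure k k̄`
  (antecedent), descend the resolution to a finite purely inseparable level `K` (Görtz–Wedhorn (10.13) limit
  formalism + fpqc/flat descent), then descend `HasResolution` down the tower of simple height-one radicial steps
  `K ⊇ … ⊇ k` (induction on `[K : k]`).
* `oneRootStep_of_descentPerfectToAll` — the converse (trivial: the crux's conclusion `ResolutionInChar p` resolves
  `X` directly).
* `descentPerfectToAll_iff_oneRootStep` — hence the crux (Temkin 2008, Question 3.3.3: perfect ⇒ all fields) is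
  equivalent to its smallest instance above the ground field: ONE scalar, height one, degree `p`. Complementary to
  `descentPerfectToAll_of_robustLevelInseparable` (p81501, line arc-special-fibre-transversality), which isolates the
  MacLane-obstructed residual INSIDE `k`.

The one-root statement is summit-implied and no proof of it is known in print; nothing here claims it.
-/

noncomputable section

set_option linter.dupNamespace false -- mandated namespace of this single-conjunct summit

open CategoryTheory CategoryTheory.Limits AlgebraicGeometry
open Literature.AlgebraicGeometry.Resolution

namespace Summit.ResolutionOfSingularities.ResolutionOfSingularities.Theorems

/-- **The crux follows from the one-root-of-a-constant step.** The hypothesis is verbatim the open stub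
`stub_oneRootStep` of the line `root-of-a-constant`: for every prime `p`, assuming resolution of reduced separated
finite-type schemes over all perfect fields of characteristic `p`, for every field `k` of characteristic `p`, every
`a ∈ k ∖ k^p`, `K = k(α)` with `α^p = a`, and every reduced separated `k`-scheme `X` of finite type: if the
reduction `Z` of `X ⊗_k K` (a reduced closed subscheme with full support) has a resolution, so does `X`. Everything
else (perfect closure, limit descent, flat/fpqc descent, the radicial tower) is proved in the tree. [folklore] -/
theorem descentPerfectToAll_of_oneRootStep : (∀ (p : ℕ) [Fact p.Prime], (∀ (κ : Type) [Field κ] [CharP κ p] [PerfectField κ] (Z : Scheme.{0}) (h : Z ⟶ Spec (.of κ)), IsSeparated h → LocallyOfFiniteType h → QuasiCompact h → IsReduced Z → Scheme.HasResolution Z) → ∀ (k K : Type) [Field k] [Field K] [Algebra k K] [CharP k p] (a : k) (α : K), (∀ b : k, b ^ p ≠ a) → α ^ p = algebraMap k K a → IntermediateField.adjoin k {α} = ⊤ → ∀ (X : Scheme.{0}) (f : X ⟶ Spec (.of k)), IsSeparated f → LocallyOfFiniteType f → QuasiCompact f → IsReduced X → ∀ (Z : Scheme.{0}) (ι : Z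 ⟶ pullback f (Spec.map (CommRingCat.ofHom (algebraMap k K)))), IsClosedImmersion ι → Surjective ι → IsReduced Z → Scheme.HasResolution Z → Scheme.HasResolution X) → Summit.ResolutionOfSingularities.ResolutionOfSingularities.Theses.WeightedInvariant.DescentPerfectToAll := by
  intro hstep p hp H k _ _ X f hsep hlft hqc hred
  haveI : Fact p.Prime := ⟨hp⟩
  -- the ambient perfect, purely inseparable extension: the perfect closure of `k` in an algebraic closure
  let Ω : Type := ↥(perfectClosure k (AlgebraicClosure k))
  haveI : CharP Ω p := charP_of_injective_algebraMap (algebraMap k Ω).injective p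
  -- resolve the reduction of `X ⊗_k Ω` by the antecedent
  obtain ⟨W, ιW, hcl, hsurj, hWred, Y, π, hπ⟩ := stub_perfectBaseResolution p H k Ω X f hsep hlft hqc
  haveI := hπ.isProper
  haveI := hcl
  have hg : IsProper (π ≫ ιW) := inferInstance
  -- descend the data to a finite level
  obtain ⟨K, hK, YK, gK, e, t, hgK, ht₁, ht₂, hsq⟩ :=
    stub_descendResolutionData k Ω X f hsep hlft hqc Y (π ≫ ιW) hg
  -- the reduction of `X ⊗_k K` has a resolution
  obtain ⟨Z, ιZ, hZ₁, hZ₂, hZ₃, hZ₄⟩ :=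
    stub_descendResolutionProps k Ω K X f hsep hlft hqc W ιW hcl hsurj hWred Y π hπ YK gK e t hgK ht₁ ht₂ hsq
  haveI : FiniteDimensional k K := hK
  -- descend along the finite purely inseparable `K/k`, one `p`-th root at a time
  exact stub_towerInduction p (hstep p H) k K X f hsep hlft hqc hred Z ιZ hZ₁ hZ₂ hZ₃ hZ₄

/-- The converse: the crux implies the one-root step (its conclusion `ResolutionInChar p` resolves `X` outright,
ignoring `Z`). [folklore] -/
theorem oneRootStep_of_descentPerfectToAll (h : Summit.ResolutionOfSingularities.ResolutionOfSingularities.Theses.WeightedInvariant.DescentPerfectToAll) : ∀ (p : ℕ) [Fact p.Prime], (∀ (κ : Type) [Field κ] [CharP κ p] [PerfectField κ] (Z : Scheme.{0}) (h : Z ⟶ Spec (.of κ)), IsSeparated h → LocallyOfFiniteType h → QuasiCompact h → IsReduced Z → Scheme.HasResolution Z) → ∀ (k K : Type) [Field k] [Field K] [Algebra k K] [CharP k p] (a : k) (α : K), (∀ b : k, b ^ p ≠ a) → α ^ p = algebraMap k K a → IntermediateField.adjoin k {α} = ⊤ → ∀ (X : Scheme.{0}) (f : X ⟶ Spec (.of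 k)), IsSeparated f → LocallyOfFiniteType f → QuasiCompact f → IsReduced X → ∀ (Z : Scheme.{0}) (ι : Z ⟶ pullback f (Spec.map (CommRingCat.ofHom (algebraMap k K)))), IsClosedImmersion ι → Surjective ι → IsReduced Z → Scheme.HasResolution Z → Scheme.HasResolution X := by
  intro p hp H k K _ _ _ _ _ _ _ _ _ X f hsep hlft hqc hred _ _ _ _ _ _
  exact h p hp.out H k X f hsep hlft hqc hred

/-- **`DescentPerfectToAll` ⟺ the one-root-of-a-constant step** (Temkin's perfect-to-all question is equivalent to
its smallest instance above the ground field). [folklore] -/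
theorem descentPerfectToAll_iff_oneRootStep : Summit.ResolutionOfSingularities.ResolutionOfSingularities.Theses.WeightedInvariant.DescentPerfectToAll ↔ (∀ (p : ℕ) [Fact p.Prime], (∀ (κ : Type) [Field κ] [CharP κ p] [PerfectField κ] (Z : Scheme.{0}) (h : Z ⟶ Spec (.of κ)), IsSeparated h → LocallyOfFiniteType h → QuasiCompact h → IsReduced Z → Scheme.HasResolution Z) → ∀ (k K : Type) [Field k] [Field K] [Algebra k K] [CharP k p] (a : k) (α : K), (∀ b : k, b ^ p ≠ a) → α ^ p = algebraMap k K a → IntermediateField.adjoin k {α} = ⊤ → ∀ (X : Scheme.{0}) (f : X ⟶ Spec (.of k)), IsSeparated f → LocallyOfFiniteType f → QuasiCompact f → IsReduced X → ∀ (Z : Scheme.{0}) (ι : Z ⟶ pullback f (Spec.map (CommRingCat.ofHom (algebraMap k K)))), IsClosedImmersion ι → Surjective ι → IsReduced Z → Scheme.HasResolution Z → Scheme.HasResolution X) :=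
  ⟨oneRootStep_of_descentPerfectToAll, descentPerfectToAll_of_oneRootStep⟩

end Summit.ResolutionOfSingularities.ResolutionOfSingularities.Theorems

end
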